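import Mathlib.LinearAlgebra.Dual.Lemmas
import Mathlib.LinearAlgebra.FreeModule.PID
import Mathlib.LinearAlgebra.FreeModule.Finite.Matrix
import Mathlib.LinearAlgebra.Dimension.Localization
import Mathlib.Algebra.Module.Torsion.Basic
import Literature.AlgebraicTopology.SingularHomology.CapProduct
import HarnessLib

/-!
# The universal coefficient theorem for cohomology (named facts) and ranks of induced maps
(trunk G04 AlgTop)

A. Hatcher, *Algebraic Topology* (2002), §3.1:

* Thm. 3.2 (p. 195) with pp. 198–199: for every space `X` the Kronecker map
  `h : Hⁿ(X; G) → Hom(Hₙ(X), G)` sits in a natural split short exact sequence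
  `0 → Ext(Hₙ₋₁(X), G) → Hⁿ(X; G) → Hom(Hₙ(X), G) → 0` (singular chains are free; p. 197: the
  same over any principal ideal domain `R`, with `Hom_R`, `Ext_R` and `Hₙ(X; R)`).  We vendor the
  two consequences used for duality on manifolds as **named facts** about the tree's Kronecker
  pairing `Literature.kroneckerPairing R R X n : Hⁿ(X; R) →ₗ[R] (Hₙ(X; R) →ₗ[R] R)`:
  `Literature.AlgebraicTopology.SingularHomology.kroneckerMap_surjective` (`h` is onto) and `Literature.isTorsion_ker_kroneckerMap`
  (`ker h = Ext_R(Hₙ₋₁(X; R), R)` is a torsion module when `Hₙ₋₁(X; R)` is finitely generated;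
  p. 196: "`Ext(H, ℤ)` is isomorphic to the torsion subgroup of `H` if `H` is finitely
  generated").
* PROVED consequence (**ranks of induced maps**): for `f : X → Y` between spaces with finitely
  generated (co)homology in degree `p` over a principal ideal domain `R`,
  `rank (im f^* : Hᵖ(Y; R) → Hᵖ(X; R)) = rank (im f_* : Hₚ(X; R) → Hₚ(Y; R))`
  (`Literature.AlgebraicTopology.SingularHomology.finrank_range_cohomologyMap_eq_finrank_range_homologyMap`): by naturality of the
  Kronecker pairing (`Literature.AlgebraicTopology.SingularHomology.kroneckerPairing_map`, proved in `CapProduct.lean`) `h_X ∘ f^* = (f_*)ᵀ ∘ h_Y`,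
  `h_Y` is onto and `ker h_X` is torsion, and the rank of the image of a transpose equals the rank
  of the image (`Literature.AlgebraicTopology.SingularHomology.finrank_range_dualMap_eq`, proved here over a PID from the structure of
  finitely generated modules: duals kill torsion, torsion-free quotients are free).

Mathlib (pinned) has `LinearMap.finrank_range_dualMap_eq_finrank_range` and
`Subspace.dual_finrank_eq` only over fields; the PID versions below are new (proved), as is
everything topological.  Nothing is asserted except the two cited named facts (D-0014).

## References

* A. Hatcher, *Algebraic Topology*, CUP 2002, §3.1, Thm. 3.2 (p. 195), p. 196, Cor. 3.3,
  pp. 197–199. [Hatcher2002]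
-/

noncomputable section

open CategoryTheory

universe u v

namespace Literature.AlgebraicTopology.SingularHomology

/-! ### Linear algebra over a principal ideal domain: duals and ranks -/

section Domain

variable {R : Type v} [CommRing R] [IsDomain R]
variable {N A B P P' : Type*} [AddCommGroup N] [Module R N] [AddCommGroup A] [Module R A]
  [AddCommGroup B] [Module R B] [AddCommGroup P] [Module R P] [AddCommGroup P'] [Module R P']

/-- A linear functional kills torsion elements (over a domain). [folklore] -/
lemma dual_apply_eq_zero_of_mem_torsion (φ : Module.Dual R N) {t : N} (ht : t ∈ Submodule.torsion R N) :
    φ t = 0 := by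
  obtain ⟨⟨r, hr⟩, hrt⟩ := (Submodule.mem_torsion_iff t).mp ht
  have h : r * φ t = 0 := by
    rw [← smul_eq_mul, ← map_smul]
    change φ (r • t) = 0
    rw [show r • t = 0 from hrt, map_zero]
  exact (mul_eq_zero.mp h).resolve_left (nonZeroDivisors.ne_zero hr)

/-- A finitely generated torsion module has rank zero. [folklore] -/
lemma finrank_eq_zero_of_le_torsion [IsNoetherianRing R] [Module.Finite R N] {T : Submodule R N}
    (hT : T ≤ Submodule.torsion R N) : Module.finrank R ↥T = 0 := by
  haveI : Module.Finite R ↥T := Module.Finite.of_injective T.subtype Subtype.val_injective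
  refine Module.finrank_eq_zero_iff.mpr fun x => ?_
  obtain ⟨⟨r, hr⟩, hrx⟩ := (Submodule.mem_torsion_iff (x : N)).mp (hT x.2)
  refine ⟨r, nonZeroDivisors.ne_zero hr, Subtype.ext ?_⟩
  exact hrx

/-- `rank (N ⧸ torsion) = rank N` for `N` finitely generated. [folklore] -/
lemma finrank_quotient_torsion [IsNoetherianRing R] [Module.Finite R N] :
    Module.finrank R (N ⧸ Submodule.torsion R N) = Module.finrank R N := by
  have h := Submodule.finrank_quotient_add_finrank (Submodule.torsion R N)
  rw [finrank_eq_zero_of_le_torsion (le_refl _), add_zero] at h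
  exact h

/-- Mapping a submodule forward along a linear map whose kernel is torsion does not change its
rank. [folklore] -/
theorem finrank_map_eq_of_ker_le_torsion [IsNoetherianRing R] [Module.Finite R P] (κ : P →ₗ[R] P')
    (hκ : LinearMap.ker κ ≤ Submodule.torsion R P) (S : Submodule R P) :
    Module.finrank R ↥(S.map κ) = Module.finrank R ↥S := by
  haveI : Module.Finite R ↥S := Module.Finite.of_injective S.subtype Subtype.val_injective
  have h := Submodule.finrank_quotient_add_finrank (LinearMap.ker (κ.domRestrict S))
  rw [← LinearEquiv.finrank_eq (κ.domRestrict S).quotKerEquivRange.symm, LinearMap.range_domRestrict]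
    at h
  have h0 : Module.finrank R ↥(LinearMap.ker (κ.domRestrict S)) = 0 := by
    refine finrank_eq_zero_of_le_torsion (N := ↥S) fun x hx => ?_
    have hx' : (x : P) ∈ LinearMap.ker κ := by
      rw [LinearMap.mem_ker] at hx ⊢
      exact hx
    obtain ⟨a, hax⟩ := (Submodule.mem_torsion_iff (x : P)).mp (hκ hx')
    exact (Submodule.mem_torsion_iff x).mpr ⟨a, Subtype.ext hax⟩
  omega

end Domain

section PID

variable {R : Type v} [CommRing R] [IsDomain R] [IsPrincipalIdealRing R]
variable {N A B P P' : Type*} [AddCommGroup N] [Module R N] [AddCommGroup A] [Module R A]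
  [AddCommGroup B] [Module R B] [AddCommGroup P] [Module R P] [AddCommGroup P'] [Module R P']

/-- **The dual of a finitely generated module over a PID has the same rank**:
`rank Hom(N, R) = rank N` (Hatcher 2002, §3.1, p. 196: "`Hom(H, ℤ)` is isomorphic to the free part
of `H` if `H` is finitely generated").  Proof: functionals kill torsion, so
`Hom(N, R) ≅ Hom(N/T, R)`, and `N/T` is free of rank `rank N`. [cite: Hatcher2002, §3.1 p. 196] -/
theorem finrank_dual_eq [Module.Finite R N] :
    Module.finrank R (Module.Dual R N) = Module.finrank R N := by
  set T := Submodule.torsion R N with hT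
  -- `Hom(N/T, R) ≃ Hom(N, R)` by precomposition with the quotient map
  have hsurj : Function.Surjective (T.mkQ.dualMap : Module.Dual R (N ⧸ T) →ₗ[R] Module.Dual R N) := by
    intro φ
    refine ⟨T.liftQ φ fun t ht => ?_, ?_⟩
    · rw [LinearMap.mem_ker]
      exact dual_apply_eq_zero_of_mem_torsion φ ht
    · ext x
      rfl
  have hinj : Function.Injective (T.mkQ.dualMap : Module.Dual R (N ⧸ T) →ₗ[R] Module.Dual R N) :=
    LinearMap.dualMap_injective_of_surjective (Submodule.mkQ_surjective T)
  have e : Module.Dual R (N ⧸ T) ≃ₗ[R] Module.Dual R N := LinearEquiv.ofBijective _ ⟨hinj, hsurj⟩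
  rw [← e.finrank_eq, Module.finrank_linearMap_self, finrank_quotient_torsion]

/-- The dual of a finitely generated module over a PID is finitely generated. [folklore] -/
instance finite_dual [Module.Finite R N] : Module.Finite R (Module.Dual R N) := by
  set T := Submodule.torsion R N with hT
  have hsurj : Function.Surjective (T.mkQ.dualMap : Module.Dual R (N ⧸ T) →ₗ[R] Module.Dual R N) := by
    intro φ
    refine ⟨T.liftQ φ fun t ht => ?_, ?_⟩
    · rw [LinearMap.mem_ker]
      exact dual_apply_eq_zero_of_mem_torsion φ ht
    · ext x
      rfl
  exact Module.Finite.of_surjective _ hsurj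

/-- **The image of the transpose has the rank of the image**: for `f : A → B` between finitely
generated modules over a PID, `rank (im fᵀ : Hom(B, R) → Hom(A, R)) = rank (im f)`.
Proof: `ker fᵀ` is the annihilator of `im f`, i.e. `Hom(B / im f, R)`, of rank
`rank B − rank (im f)`; rank–nullity for `fᵀ` and `finrank_dual_eq`.  (Over a field this is
Mathlib's `LinearMap.finrank_range_dualMap_eq_finrank_range`.) [folklore] -/
theorem finrank_range_dualMap_eq [Module.Finite R A] [Module.Finite R B] (f : A →ₗ[R] B) :
    Module.finrank R ↥(LinearMap.range f.dualMap) = Module.finrank R ↥(LinearMap.range f) := by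
  have h1 := Submodule.finrank_quotient_add_finrank (LinearMap.ker f.dualMap)
  rw [← LinearEquiv.finrank_eq f.dualMap.quotKerEquivRange.symm, finrank_dual_eq] at h1
  have h2 : Module.finrank R ↥(LinearMap.ker f.dualMap) =
      Module.finrank R (B ⧸ LinearMap.range f) := by
    rw [LinearMap.ker_dualMap_eq_dualAnnihilator_range,
      ← (Submodule.dualQuotEquivDualAnnihilator (LinearMap.range f)).finrank_eq, finrank_dual_eq]
  have h3 := Submodule.finrank_quotient_add_finrank (LinearMap.range f)
  omega

end PID

/-! ### The universal coefficient theorem: named facts -/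

section UCT

variable (R : Type v) [CommRing R] (X : Type u) [TopologicalSpace X]

/-- **Universal coefficients, surjectivity of the Kronecker map** (Hatcher 2002, §3.1, Thm. 3.2,
p. 195, in its topological guise pp. 198–199: the sequence
`0 → Ext(Hₙ₋₁(X), G) → Hⁿ(X; G) —h→ Hom(Hₙ(X), G) → 0` is split exact, "since the chain groups
`Cₙ(X)` are free"; p. 197: verbatim over a principal ideal domain `R`, with `Hₙ(X; R)`, `Hom_R`
and `Ext_R`).  Vendored consequence: for `R` a PID, the Kronecker map
`h : Hⁿ(X; R) → Hom_R(Hₙ(X; R), R)`, `a ↦ ⟨a, ·⟩` (`Literature.kroneckerPairing R R X n`), is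
surjective.  Named fact. [cite: Hatcher2002, §3.1 Thm. 3.2 (p. 195) and pp. 197–199] -/
def kroneckerMap_surjective [IsDomain R] [IsPrincipalIdealRing R] (n : ℕ) : Prop :=
  Function.Surjective (kroneckerPairing R R X n)

/-- **Universal coefficients, the kernel of the Kronecker map is torsion** (Hatcher 2002, §3.1,
Thm. 3.2, p. 195 and pp. 197–199: `ker h = Ext_R(Hₙ(X; R), R)` in degree `n + 1`; p. 196:
"`Ext(H, ℤ)` is isomorphic to the torsion subgroup of `H` if `H` is finitely generated", and over
a PID `Ext_R(R/(a), R) ≅ R/(a)`, p. 197).  Vendored consequence: for `R` a PID and `Hₙ(X; R)`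
finitely generated, every class in the kernel of `h : Hⁿ⁺¹(X; R) → Hom_R(Hₙ₊₁(X; R), R)` is a
torsion element.  Named fact. [cite: Hatcher2002, §3.1 Thm. 3.2 (p. 195), p. 196, p. 197] -/
def ker_kroneckerMap_le_torsion [IsDomain R] [IsPrincipalIdealRing R] (n : ℕ) : Prop :=
  ∀ [Module.Finite R (singularHomology R R X n)],
    LinearMap.ker (kroneckerPairing R R X (n + 1)) ≤
      Submodule.torsion R (singularCohomology R R X (n + 1))

end UCT

/-! ### Ranks of induced maps on cohomology and on homology agree (proved) -/

section Rank

variable {R : Type v} [CommRing R]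
variable {X Y : Type u} [TopologicalSpace X] [TopologicalSpace Y]

/-- Naturality of the Kronecker map as an identity of linear maps:
`h_X ∘ f^* = (f_*)ᵀ ∘ h_Y` (Hatcher 2002, §3.1, p. 201, naturality of `h`; from
`Literature.AlgebraicTopology.SingularHomology.kroneckerPairing_map`, `⟨f^* a, c⟩ = ⟨a, f_* c⟩`). [cite: Hatcher2002, §3.1 p. 201] -/
theorem kroneckerPairing_comp_cohomologyMap (f : C(X, Y)) (p : ℕ) :
    (kroneckerPairing R R X p).comp (singularCohomology.map R R f p).hom =
      (singularHomology.map R R f p).hom.dualMap.comp (kroneckerPairing R R Y p) := by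
  refine LinearMap.ext fun a => LinearMap.ext fun c => ?_
  exact kroneckerPairing_map f a c

variable [IsDomain R] [IsPrincipalIdealRing R]

/-- **`rank (im f^*) = rank (im f_*)`.**  For `f : X → Y` and a principal ideal domain `R`, if
the Kronecker map of `Y` in degree `p` is onto (universal coefficients,
`kroneckerMap_surjective`, hypothesis `hY`), the kernel of the Kronecker map of `X` in degree
`p` is torsion (`ker_kroneckerMap_le_torsion`, hypothesis `hX`) and the (co)homology modules
involved are finitely generated, then the images of `f^* : Hᵖ(Y; R) → Hᵖ(X; R)` and of
`f_* : Hₚ(X; R) → Hₚ(Y; R)` have the same rank: `h_X ∘ f^* = (f_*)ᵀ ∘ h_Y`, `h_X` changes no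
rank of a submodule, `h_Y` is onto, and `rank (im (f_*)ᵀ) = rank (im f_*)`
(`finrank_range_dualMap_eq`).  This is the form in which universal coefficients enter
"half lives, half dies" (Thom 1952, Cor. V.8).  PROVED. [cite: Hatcher2002, §3.1 Thm. 3.2 and Cor. 3.3] -/
theorem finrank_range_cohomologyMap_eq_finrank_range_homologyMap (f : C(X, Y)) {p : ℕ}
    (hY : Function.Surjective (kroneckerPairing R R Y p))
    (hX : LinearMap.ker (kroneckerPairing R R X p) ≤
      Submodule.torsion R (singularCohomology R R X p))
    [Module.Finite R (singularCohomology R R X p)] [Module.Finite R (singularHomology R R X p)]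
    [Module.Finite R (singularHomology R R Y p)] :
    Module.finrank R ↥(LinearMap.range (singularCohomology.map R R f p).hom) =
      Module.finrank R ↥(LinearMap.range (singularHomology.map R R f p).hom) := by
  calc Module.finrank R ↥(LinearMap.range (singularCohomology.map R R f p).hom)
      = Module.finrank R
          ↥((LinearMap.range (singularCohomology.map R R f p).hom).map (kroneckerPairing R R X p)) :=
        (finrank_map_eq_of_ker_le_torsion _ hX _).symm
    _ = Module.finrank R
          ↥(LinearMap.range ((kroneckerPairing R R X p).comp (singularCohomology.map R R f p).hom)) := by
        rw [LinearMap.range_comp]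
    _ = Module.finrank R ↥(LinearMap.range
          ((singularHomology.map R R f p).hom.dualMap.comp (kroneckerPairing R R Y p))) := by
        rw [kroneckerPairing_comp_cohomologyMap]
    _ = Module.finrank R ↥(LinearMap.range (singularHomology.map R R f p).hom.dualMap) := by
        rw [LinearMap.range_comp_of_range_eq_top _ (LinearMap.range_eq_top.2 hY)]
    _ = Module.finrank R ↥(LinearMap.range (singularHomology.map R R f p).hom) :=
        finrank_range_dualMap_eq _

end Rank

end Literature.AlgebraicTopology.SingularHomology

end
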